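import Mathlib
import HarnessLib
import Summits.NavierStokesRegularity.NavierStokesRegularity.Theorems.PoloidalWindowDoorPoloidalWindowRigidityZShockSlopeFunctionLocal
import Summits.NavierStokesRegularity.NavierStokesRegularity.Theorems.PoloidalWindowDoorPoloidalWindowRigidityZShockAutonomySlab

/-!
# Crux K2 `PoloidalWindowRigidity` (stmt-NavierStokesRegularity-19708), line `z_shock` — L0(b) IN SPACE–TIME (bridge B1 of the g12
# repair census): near EVERY slab point off `{∇ₕv₂ = 0}` the slope is ONE function JOINTLY REAL-ANALYTIC IN `(t, w)`

`--supports stmt-NavierStokesRegularity-19708 --as helper` (leafhand-ns-poloidalwindowdoor-3 g13, cell decomp-ns, 2026-08-31).  Def-free.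
**No stub and no summit is closed by this file; Navier–Stokes regularity is NOT proved here (rung 0).**

WHY.  The deciding stub `stub_zShockThickAut` (skeleton sha16 c3e8eee2) carries the LOCAL autonomy clause `∂_z v_b = g(t, v₂)·∂_b v₂` on
ONE sub-window, with NO regularity on `g`.  L0 of the card is in the tree IN SPACE (slice by slice: `…ZShockAutonomyGlobal`,
`…ZShockSlopeFunctionLocal/Analytic/Patching/Connected`, `…ZShockAutonomyPropagation`) and, since g12, IN SPACE–TIME for the MINORS
(`…ZShockAutonomySlab.minors_eq_zero_on_slab_of_class_autonomy`).  What no file provides is a slope FUNCTION regular JOINTLY in the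
time and the value — the format in which the Navier–Stokes dynamics of K2-p2's stratum (SF) «slope a function of `(t, v₂)`» is typed
(`…SlopeFunctionPressure.slopeFunction_pressure`, `…SlopeFunctionSource`, `…SlopeFunctionPassive`: `m : ℝ → ℝ → ℝ`,
`ContDiff ℝ 2 (uncurry m)`).  This file supplies it (bridge B1 of the AUT-REDUCTION census of leafhand-3 g12; B2 = LOCAL pressure law next):

* `exists_comp₂_of_fderiv_ker` — **parametric functional dependence** on a complete real normed space `E`: `T, ℓ : E →L[ℝ] ℝ`
  («time» and «pivot» coordinates), `e, f₀ ∈ E` with `ℓ e = 1`, `T e = 0`, `T f₀ = 1`, `ℓ f₀ = 0`; `Λ, W` of class `Cⁿ` at `a`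
  (`n ≠ 0`, `n = ω` allowed), `DW(a) e ≠ 0`, and near `a` the derivative `DΛ(x)` kills `ker T ∩ ker DW(x)`.  Then
  `Λ = g ∘ (T, W)` near `a` for a STRUCTURE FUNCTION `g : ℝ × ℝ → ℝ` of class `Cⁿ` at `(T a, W a)` (Zorich's functional-dependence
  proposition with ONE parameter; straightening map `Θ x = x + (W x − ℓ x)·e`, `Cⁿ` inverse function theorem, mean value theorem on the
  affine slices `{T = τ, ℓ = s}` of a ball). [cite: ZorichAnalysisI2015, §8.6.3 Prop. 1]
* `exists_slope_function₂` — quotient form: `N = g(T, W)·D` near `a` when `D = DW(·) e`, `D a ≠ 0` and the cleared-denominator minors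
  `D·DN(h) − N·DD(h)` vanish on `ker T ∩ ker DW` near `a`;  `fderiv_slice_apply` — slice vs. joint derivatives on `ℝ × X`.
* ★ `slopeFunction_spaceTime_of_class_autonomy` — **class entry (B1)**: class binders of `stub_zShockThickAut` (Type-I rate, continuity,
  Oseen identity, divergence-free, poloidal) + the stub's local autonomy clause on an open nonempty `W₁` of the slab ⟹ for EVERY `t₀ < 0`
  and EVERY `x₀` with `∇ₕv₂(t₀,x₀) ≠ 0` there are `m : ℝ → ℝ → ℝ` with `uncurry m` REAL-ANALYTIC (`ContDiffAt ℝ ω`) at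
  `(t₀, v₂(t₀,x₀))` and an open space–time `O ∋ (t₀,x₀)` in the slab on which `∂_z v_b = m(t, v₂)·∂_b v₂` for both `b ≠ 2`
  (slab minors of g12 + joint analyticity `…Ancient.analyticOnNhd_uncurry` / `…K2OfLrcSlope.analyticOnNhd_uncurry_fderiv_entry` + the
  wedge law `…ZShockThInstantSlope.wedge_slice_of_class`).
So the z_shock Aut column is, locally in space–time off the analytic set `{∇ₕv₂ = 0}`, LITERALLY K2-p2's stratum (SF) with an analytic
slope function; K2-p2's files ask beyond this only GLOBALITY of `m`, which the local pressure law (B2) removes.  presearch: parametric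
functional dependence — classical (Zorich §8.6.3 / rank theorem); Mathlib: inverse function theorem only; tree: the parameter-free versions
cited above. [folklore]
-/

noncomputable section

namespace Summit.NavierStokesRegularity.NavierStokesRegularity.Theorems.PoloidalWindowDoorPoloidalWindowRigidityZShockSlopeFunctionSpaceTime

-- the problem directory repeats the summit name (`NavierStokesRegularity/NavierStokesRegularity`)
set_option linter.dupNamespace false

open Set Filter Topology Function Metric
open scoped RealInnerProductSpace InnerProductSpace ContDiff
open Literature.Analysis Literature.Analysis.FluidPDE
open Summit.NavierStokesRegularity.NavierStokesRegularity.Theorems.PoloidalWindowDoorPoloidalWindowRigidityZShockSlopeFunctionLocal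
  (exists_shearEquiv shear_apply)
open Summit.NavierStokesRegularity.NavierStokesRegularity.Theorems.LocalSineTubeDoorProfileAlignedWindowRigidityAncient
open Summit.NavierStokesRegularity.NavierStokesRegularity.Theorems.PoloidalWindowDoorPoloidalWindowRigidityK2OfLrcSlope
open Summit.NavierStokesRegularity.NavierStokesRegularity.Theorems.PoloidalWindowDoorPoloidalWindowRigidityZShockAutonomySlab
open Summit.NavierStokesRegularity.NavierStokesRegularity.Theorems.PoloidalWindowDoorPoloidalWindowRigidityZShockThInstantSlope

/-! ## Parametric functional dependence on a Banach space -/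

section Abstract

variable {E : Type*} [NormedAddCommGroup E] [NormedSpace ℝ E] [CompleteSpace E]

/-- **Parametric functional dependence (one parameter `T`, structure function of class `Cⁿ`).**  Let `E` be a complete real normed
space, `T ℓ : E →L[ℝ] ℝ`, `e f₀ : E` with `ℓ e = 1`, `T e = 0`, `T f₀ = 1`, `ℓ f₀ = 0`.  Let `Λ W : E → ℝ` be `Cⁿ` at `a` (`n ≠ 0`),
`DW(a) e ≠ 0`, and suppose that for all `x` near `a` the derivative `DΛ(x)` vanishes on `ker T ∩ ker DW(x)`.  Then there is
`g : ℝ × ℝ → ℝ`, of class `Cⁿ` at `(T a, W a)`, with `Λ x = g (T x, W x)` for all `x` near `a`.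
[cite: ZorichAnalysisI2015, §8.6.3 Prop. 1] -/
theorem exists_comp₂_of_fderiv_ker {n : WithTop ℕ∞} (hn : n ≠ 0)
    {Λ W : E → ℝ} {a e f₀ : E} {T ℓ : E →L[ℝ] ℝ}
    (hℓe : ℓ e = 1) (hTe : T e = 0) (hTf : T f₀ = 1) (hℓf : ℓ f₀ = 0)
    (hΛ : ContDiffAt ℝ n Λ a) (hW : ContDiffAt ℝ n W a) (he : fderiv ℝ W a e ≠ 0)
    (hker : ∀ᶠ x in 𝓝 a, ∀ h : E, T h = 0 → fderiv ℝ W x h = 0 → fderiv ℝ Λ x h = 0) :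
    ∃ g : ℝ × ℝ → ℝ, ContDiffAt ℝ n g (T a, W a) ∧ ∀ᶠ x in 𝓝 a, Λ x = g (T x, W x) := by
  have hn1 : (1 : WithTop ℕ∞) ≤ n := ENat.one_le_iff_ne_zero_withTop.mpr hn
  -- ## the straightening map `Θ x = x + (W x − ℓ x) • e` and its invertible derivative at `a`
  obtain ⟨A, hA⟩ := exists_shearEquiv (fderiv ℝ W a) ℓ e he hℓe
  set Θ : E → E := fun x => x + (W x - ℓ x) • e with hΘ
  have hΘd : HasFDerivAt Θ (A : E →L[ℝ] E) a := by
    rw [hA]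
    exact (hasFDerivAt_id a).add
      (((hW.differentiableAt hn).hasFDerivAt.sub ℓ.hasFDerivAt).smul_const e)
  have hΘc : ContDiffAt ℝ n Θ a :=
    contDiffAt_id.add ((hW.sub ℓ.contDiff.contDiffAt).smul contDiffAt_const)
  have hstrict : HasStrictFDerivAt Θ (A : E →L[ℝ] E) a := hΘc.hasStrictFDerivAt' hΘd hn
  -- ## the local inverse `Ψ`
  set Ψ : E → E := hΘc.localInverse hΘd hn with hΨ
  have hΨΘ : ∀ᶠ x in 𝓝 a, Ψ (Θ x) = x := hstrict.eventually_left_inverse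
  have hΘΨ : ∀ᶠ y in 𝓝 (Θ a), Θ (Ψ y) = y := hstrict.eventually_right_inverse
  have hΨa : Ψ (Θ a) = a := hstrict.localInverse_apply_image
  have hΨt : Tendsto Ψ (𝓝 (Θ a)) (𝓝 a) := hstrict.localInverse_tendsto
  have hΨc : ContDiffAt ℝ n Ψ (Θ a) := hΘc.to_localInverse hΘd hn
  -- coordinates of `Θ`
  have hℓΘ : ∀ x, ℓ (Θ x) = W x := by
    intro x; simp only [hΘ, map_add, map_smul, smul_eq_mul, hℓe]; ring
  have hTΘ : ∀ x, T (Θ x) = T x := by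
    intro x; simp only [hΘ, map_add, map_smul, smul_eq_mul, hTe]; ring
  -- ## `Ft := Λ ∘ Ψ`, so that `Λ = Ft ∘ Θ` near `a`
  obtain ⟨Ft, hFt⟩ : ∃ Ft : E → ℝ, ∀ y, Ft y = Λ (Ψ y) := ⟨fun y => Λ (Ψ y), fun _ => rfl⟩
  have hFtfun : Ft = fun y => Λ (Ψ y) := funext hFt
  have hFtc : ContDiffAt ℝ n Ft (Θ a) := by
    have hfa : ContDiffAt ℝ n Λ (Ψ (Θ a)) := by rw [hΨa]; exact hΛ
    rw [hFtfun]
    exact hfa.comp (Θ a) hΨc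
  have hfeq : ∀ᶠ x in 𝓝 a, Λ x = Ft (Θ x) :=
    hΨΘ.mono fun x hx => by rw [hFt, hx]
  -- `C¹` consequences near `a` and near `Θ a`
  have hΛ1 : ∀ᶠ x in 𝓝 a, ContDiffAt ℝ 1 Λ x := (hΛ.of_le hn1).eventually (by simp)
  have hW1 : ∀ᶠ x in 𝓝 a, ContDiffAt ℝ 1 W x := (hW.of_le hn1).eventually (by simp)
  have hFt1 : ∀ᶠ y in 𝓝 (Θ a), ContDiffAt ℝ 1 Ft y := (hFtc.of_le hn1).eventually (by simp)
  have hWe : ∀ᶠ x in 𝓝 a, fderiv ℝ W x e ≠ 0 := by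
    have h0 : (0 : WithTop ℕ∞) + 1 ≤ n := by simpa using hn1
    have hc : ContinuousAt (fun x => fderiv ℝ W x e) a :=
      ((hW.fderiv_right h0).continuousAt).clm_apply continuousAt_const
    exact hc.eventually_ne he
  have hΘt : Tendsto Θ (𝓝 a) (𝓝 (Θ a)) := hΘc.continuousAt
  -- ## KEY: the derivative of `Ft` at `Θ x` kills `ker T ∩ ker ℓ`, for `x` near `a`
  have hkey : ∀ᶠ x in 𝓝 a, ∀ d : E, T d = 0 → ℓ d = 0 → fderiv ℝ Ft (Θ x) d = 0 := by
    filter_upwards [hΛ1, hW1, hWe, hker, hfeq.eventually_nhds, hΘt.eventually hFt1]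
      with x hΛx hWx hWex hkerx hfeqx hFtx d hTd hℓd
    have hΘx : HasFDerivAt Θ (ContinuousLinearMap.id ℝ E + (fderiv ℝ W x - ℓ).smulRight e) x := by
      have h1 : HasFDerivAt (fun x => W x - ℓ x) (fderiv ℝ W x - ℓ) x :=
        (hWx.differentiableAt one_ne_zero).hasFDerivAt.sub ℓ.hasFDerivAt
      exact (hasFDerivAt_id x).add (h1.smul_const e)
    have hcomp : HasFDerivAt (fun x => Ft (Θ x))
        ((fderiv ℝ Ft (Θ x)).comp (ContinuousLinearMap.id ℝ E + (fderiv ℝ W x - ℓ).smulRight e)) x :=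
      (hFtx.differentiableAt one_ne_zero).hasFDerivAt.comp x hΘx
    have hfd : HasFDerivAt Λ
        ((fderiv ℝ Ft (Θ x)).comp (ContinuousLinearMap.id ℝ E + (fderiv ℝ W x - ℓ).smulRight e)) x :=
      hcomp.congr_of_eventuallyEq hfeqx
    -- the preimage direction `d - c • e`, `c = DW(x) d / DW(x) e`, lies in `ker T ∩ ker DW(x)` and is mapped to `d` by `DΘ(x)`
    set c : ℝ := fderiv ℝ W x d / fderiv ℝ W x e with hc
    have hce : c * fderiv ℝ W x e = fderiv ℝ W x d := by
      rw [hc]; field_simp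
    have hTh : T (d - c • e) = 0 := by simp [hTd, hTe]
    have hWh : fderiv ℝ W x (d - c • e) = 0 := by
      simp only [map_sub, map_smul, smul_eq_mul]
      linarith
    have hDΘ : (ContinuousLinearMap.id ℝ E + (fderiv ℝ W x - ℓ).smulRight e) (d - c • e) = d := by
      rw [shear_apply]
      have h1 : fderiv ℝ W x (d - c • e) - ℓ (d - c • e) = c := by
        rw [hWh]
        simp only [map_sub, map_smul, smul_eq_mul, hℓd, hℓe]
        ring
      rw [h1]
      simp [sub_add_cancel]
    have h0 := hkerx (d - c • e) hTh hWh
    rw [hfd.fderiv, ContinuousLinearMap.comp_apply, hDΘ] at h0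
    exact h0
  -- transport to a neighbourhood of `Θ a`
  have hkey' : ∀ᶠ y in 𝓝 (Θ a), ∀ d : E, T d = 0 → ℓ d = 0 → fderiv ℝ Ft y d = 0 := by
    filter_upwards [hΨt.eventually hkey, hΘΨ] with y hy hyy
    rwa [hyy] at hy
  have hFtd : ∀ᶠ y in 𝓝 (Θ a), DifferentiableAt ℝ Ft y :=
    hFt1.mono fun y hy => hy.differentiableAt one_ne_zero
  obtain ⟨r, hr, hball⟩ := Metric.eventually_nhds_iff_ball.1 (hFtd.and hkey')
  -- ## `Ft` is constant on the slices `{T = τ, ℓ = s}` of the ball `B(Θ a, r)`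
  have hconst : ∀ q q', q ∈ ball (Θ a) r → q' ∈ ball (Θ a) r → T q = T q' → ℓ q = ℓ q' →
      Ft q' = Ft q := by
    intro q q' hq hq' hTqq' hℓqq'
    set d : E := q' - q with hd_def
    have hTd : T d = 0 := by simp [hd_def, hTqq']
    have hℓd : ℓ d = 0 := by simp [hd_def, hℓqq']
    have hseg : ∀ s ∈ Icc (0 : ℝ) 1, q + s • d ∈ ball (Θ a) r := by
      intro s hs
      have h := (convex_ball (Θ a) r).add_smul_sub_mem hq hq' hs
      simpa [hd_def] using h
    have hG : ∀ s ∈ Icc (0 : ℝ) 1, HasDerivAt (fun σ : ℝ => Ft (q + σ • d)) 0 s := by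
      intro s hs
      obtain ⟨hdiff, hk⟩ := hball _ (hseg s hs)
      have h1 : HasDerivAt (fun σ : ℝ => q + σ • d) d s := by
        simpa using ((hasDerivAt_id s).smul_const d).const_add q
      have h2 : HasDerivAt (fun σ : ℝ => Ft (q + σ • d)) (fderiv ℝ Ft (q + s • d) d) s :=
        hdiff.hasFDerivAt.comp_hasDerivAt s h1
      rwa [hk d hTd hℓd] at h2
    have h := constant_of_has_deriv_right_zero (f := fun σ : ℝ => Ft (q + σ • d)) (a := 0) (b := 1)
      (fun s hs => (hG s hs).continuousAt.continuousWithinAt)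
      (fun s hs => (hG s (Ico_subset_Icc_self hs)).hasDerivWithinAt) 1 (right_mem_Icc.2 zero_le_one)
    simpa [hd_def] using h
  -- ## the structure function
  set L : ℝ × ℝ → E := fun p => Θ a + (p.2 - W a) • e + (p.1 - T a) • f₀ with hL
  have hLc : ContDiff ℝ n L := by
    simp only [hL]
    fun_prop
  have hLa : L (T a, W a) = Θ a := by simp [hL]
  refine ⟨fun p => Ft (L p), ?_, ?_⟩
  · have h1 : ContDiffAt ℝ n Ft (L (T a, W a)) := by rw [hLa]; exact hFtc
    exact h1.comp (T a, W a) hLc.contDiffAt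
  · have h1 : ∀ᶠ x in 𝓝 a, Θ x ∈ ball (Θ a) r := hΘt.eventually (ball_mem_nhds _ hr)
    have h2 : ∀ᶠ x in 𝓝 a, L (T x, W x) ∈ ball (Θ a) r := by
      have hpair : ContinuousAt (fun x => (T x, W x)) a := T.continuous.continuousAt.prodMk hW.continuousAt
      have hc : ContinuousAt (fun x => L (T x, W x)) a := hLc.continuous.continuousAt.comp hpair
      have h0 : L (T a, W a) ∈ ball (Θ a) r := by rw [hLa]; exact mem_ball_self hr
      exact hc.preimage_mem_nhds (isOpen_ball.mem_nhds h0)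
    filter_upwards [hfeq, h1, h2] with x hx hx1 hx2
    have hT' : T (Θ x) = T (L (T x, W x)) := by
      simp only [hL, hTΘ, map_add, map_smul, smul_eq_mul, hTe, hTf]; ring
    have hℓ' : ℓ (Θ x) = ℓ (L (T x, W x)) := by
      simp only [hL, hℓΘ, map_add, map_smul, smul_eq_mul, hℓe, hℓf]; ring
    rw [hx]
    exact (hconst _ _ hx1 hx2 hT' hℓ').symm

/-- **Parametric functional dependence, quotient form (the slope `N/D`).**  With `T, ℓ, e, f₀` as in `exists_comp₂_of_fderiv_ker`, let
`N D W : E → ℝ` be `Cⁿ` at `a` (`n ≠ 0`), `D = DW(·) e` near `a`, `D a ≠ 0`, and suppose that for `x` near `a` the cleared-denominator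
minors `D x·DN(x) h − N x·DD(x) h` vanish for every `h ∈ ker T ∩ ker DW(x)`.  Then `N = g(T, W)·D` near `a` for some `g : ℝ × ℝ → ℝ`
of class `Cⁿ` at `(T a, W a)`. [folklore] -/
theorem exists_slope_function₂ {n : WithTop ℕ∞} (hn : n ≠ 0)
    {N D W : E → ℝ} {a e f₀ : E} {T ℓ : E →L[ℝ] ℝ}
    (hℓe : ℓ e = 1) (hTe : T e = 0) (hTf : T f₀ = 1) (hℓf : ℓ f₀ = 0)
    (hN : ContDiffAt ℝ n N a) (hD : ContDiffAt ℝ n D a) (hW : ContDiffAt ℝ n W a)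
    (hDe : ∀ᶠ x in 𝓝 a, D x = fderiv ℝ W x e) (hDa : D a ≠ 0)
    (hmin : ∀ᶠ x in 𝓝 a, ∀ h : E, T h = 0 → fderiv ℝ W x h = 0 →
      D x * fderiv ℝ N x h - N x * fderiv ℝ D x h = 0) :
    ∃ g : ℝ × ℝ → ℝ, ContDiffAt ℝ n g (T a, W a) ∧ ∀ᶠ x in 𝓝 a, N x = g (T x, W x) * D x := by
  have hn1 : (1 : WithTop ℕ∞) ≤ n := ENat.one_le_iff_ne_zero_withTop.mpr hn
  have hΛ : ContDiffAt ℝ n (fun x => N x / D x) a := hN.div hD hDa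
  have he : fderiv ℝ W a e ≠ 0 := by rw [← hDe.self_of_nhds]; exact hDa
  have hDne : ∀ᶠ x in 𝓝 a, D x ≠ 0 := hD.continuousAt.eventually_ne hDa
  have hN1 : ∀ᶠ x in 𝓝 a, ContDiffAt ℝ 1 N x := (hN.of_le hn1).eventually (by simp)
  have hD1 : ∀ᶠ x in 𝓝 a, ContDiffAt ℝ 1 D x := (hD.of_le hn1).eventually (by simp)
  have hker : ∀ᶠ x in 𝓝 a, ∀ h : E, T h = 0 → fderiv ℝ W x h = 0 → fderiv ℝ (fun x => N x / D x) x h = 0 := by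
    filter_upwards [hDne, hN1, hD1, hmin] with x hDx hNx hDx1 hminx h hTh hWh
    have hN' := (hNx.differentiableAt one_ne_zero).hasFDerivAt
    have hD' := (hDx1.differentiableAt one_ne_zero).hasFDerivAt
    have hinv : HasFDerivAt (fun y => (D y)⁻¹) ((-(D x ^ 2)⁻¹) • fderiv ℝ D x) x :=
      (hasDerivAt_inv hDx).comp_hasFDerivAt x hD'
    have hprod : HasFDerivAt (fun y => N y * (D y)⁻¹)
        (N x • ((-(D x ^ 2)⁻¹) • fderiv ℝ D x) + (D x)⁻¹ • fderiv ℝ N x) x := hN'.mul hinv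
    have hfun : (fun y => N y / D y) = fun y => N y * (D y)⁻¹ := by
      funext y; rw [div_eq_mul_inv]
    rw [hfun, hprod.fderiv]
    simp only [_root_.add_apply, _root_.smul_apply, smul_eq_mul]
    have h0 := hminx h hTh hWh
    field_simp
    linear_combination h0
  obtain ⟨g, hgc, hg⟩ := exists_comp₂_of_fderiv_ker hn hℓe hTe hTf hℓf hΛ hW he hker
  refine ⟨g, hgc, ?_⟩
  filter_upwards [hg, hDne] with x hx hDx
  rw [← hx]
  field_simp

end Abstract

/-! ## Slice derivatives versus joint derivatives on `ℝ × X` -/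

/-- For `F : ℝ × X → ℝ` differentiable at `(t, x)`, the derivative of the slice `y ↦ F (t, y)` at `x` in the direction `u` is
`DF(t,x)(0, u)`. [folklore] -/
theorem fderiv_slice_apply {X : Type*} [NormedAddCommGroup X] [NormedSpace ℝ X] {F : ℝ × X → ℝ} {t : ℝ} {x : X}
    (hF : DifferentiableAt ℝ F (t, x)) (u : X) :
    fderiv ℝ (fun y => F (t, y)) x u = fderiv ℝ F (t, x) ((0 : ℝ), u) := by
  have h := (hF.hasFDerivAt.comp x (hasFDerivAt_prodMk_right (𝕜 := ℝ) t x)).fderiv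
  rw [show (fun y => F (t, y)) = F ∘ (fun y => (t, y)) from rfl, h]
  simp

/-! ## Class entry: the slope function of the z_shock Aut column is jointly analytic in `(t, v₂)` -/

/-- ★ **B1 — L0(b) in space–time for the class.**  Class binders of `stub_zShockThickAut` (Type-I rate, continuity on the slab,
unit-viscosity Oseen identity, divergence-free, poloidal along `e₃`) and the stub's LOCAL autonomy clause on an open nonempty `W₁` of the
backward slab (`∂_z v_b = g(t, v₂)·∂_b v₂` on `W₁`, `b ≠ 2`, SOME `g`).  Then for EVERY `t₀ < 0` and EVERY `x₀` with
`∇ₕv₂(t₀,x₀) ≠ 0` there are `m : ℝ → ℝ → ℝ` with `uncurry m` real-analytic (`C^ω`) at `(t₀, v₂(t₀,x₀))` and an open `O ∋ (t₀,x₀)`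
inside the slab such that `∂_z v_b(t,x) = m(t, v₂(t,x))·∂_b v₂(t,x)` for all `(t,x) ∈ O` and both `b ≠ 2` — the (SF) format of
`…SlopeFunctionPressure`, locally, with an analytic slope function. [folklore] -/
theorem slopeFunction_spaceTime_of_class_autonomy (C : ℝ) (v : ℝ → EuclideanSpace ℝ (Fin 3) → EuclideanSpace ℝ (Fin 3))
    (hrate : Literature.Analysis.FluidPDE.HasTypeITimeDecay C v)
    (hcont : ContinuousOn (Function.uncurry v) (Set.Iio (0 : ℝ) ×ˢ Set.univ))
    (hmild : ∀ s t : ℝ, s < t → t < 0 → ∀ x, v t x =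
      Literature.Analysis.UnboundedOperators.heatExtension (v s) (t - s) x -
        Literature.Analysis.FluidPDE.oseenDuhamel 1 s v v t x)
    (hdiv : ∀ t < 0, Literature.Analysis.FluidPDE.VectorCalculus.IsDivFree (v t))
    (hpol : ∀ s < 0, ∀ y, ⟪Literature.Analysis.FluidPDE.curl (v s) y, EuclideanSpace.single 2 1⟫_ℝ = 0)
    {W₁ : Set (ℝ × EuclideanSpace ℝ (Fin 3))} (hW₁ : IsOpen W₁) (hW₁s : W₁ ⊆ Set.Iio (0 : ℝ) ×ˢ Set.univ)
    (hW₁ne : W₁.Nonempty) {g : ℝ → ℝ → ℝ}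
    (haut : ∀ z ∈ W₁, ∀ b : Fin 3, b ≠ 2 →
      fderiv ℝ (v z.1) z.2 (EuclideanSpace.single 2 1) b =
        g z.1 (v z.1 z.2 2) * fderiv ℝ (v z.1) z.2 (EuclideanSpace.single b 1) 2)
    {t₀ : ℝ} (ht₀ : t₀ < 0) {x₀ : EuclideanSpace ℝ (Fin 3)}
    (hx₀ : fderiv ℝ (v t₀) x₀ (EuclideanSpace.single 0 1) 2 ≠ 0 ∨ fderiv ℝ (v t₀) x₀ (EuclideanSpace.single 1 1) 2 ≠ 0) :
    ∃ m : ℝ → ℝ → ℝ, ContDiffAt ℝ ω (Function.uncurry m) (t₀, v t₀ x₀ 2) ∧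
      ∃ O : Set (ℝ × EuclideanSpace ℝ (Fin 3)), IsOpen O ∧ (t₀, x₀) ∈ O ∧ O ⊆ Set.Iio (0 : ℝ) ×ˢ Set.univ ∧
        ∀ z ∈ O, ∀ b : Fin 3, b ≠ 2 →
          fderiv ℝ (v z.1) z.2 (EuclideanSpace.single 2 1) b =
            m z.1 (v z.1 z.2 2) * fderiv ℝ (v z.1) z.2 (EuclideanSpace.single b 1) 2 := by
  -- ## the pivot index `b₀` with `∂_{b₀} v₂(t₀,x₀) ≠ 0` and the other horizontal index `b₁`
  obtain ⟨b₀, b₁, hb₀, hb₁, hb01, hpiv, hcover⟩ : ∃ b₀ b₁ : Fin 3, b₀ ≠ 2 ∧ b₁ ≠ 2 ∧ b₀ ≠ b₁ ∧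
      fderiv ℝ (v t₀) x₀ (EuclideanSpace.single b₀ 1) 2 ≠ 0 ∧ ∀ b : Fin 3, b ≠ 2 → b = b₀ ∨ b = b₁ := by
    rcases hx₀ with h | h
    · exact ⟨0, 1, by decide, by decide, by decide, h, fun b hb => by fin_cases b <;> simp_all⟩
    · exact ⟨1, 0, by decide, by decide, by decide, h, fun b hb => by fin_cases b <;> simp_all⟩
  -- ## the space–time data
  have hSo : IsOpen (Set.Iio (0 : ℝ) ×ˢ (Set.univ : Set (EuclideanSpace ℝ (Fin 3)))) := isOpen_Iio.prod isOpen_univ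
  have haS : (t₀, x₀) ∈ Set.Iio (0 : ℝ) ×ˢ (Set.univ : Set (EuclideanSpace ℝ (Fin 3))) :=
    Set.mk_mem_prod ht₀ (Set.mem_univ _)
  set N : ℝ × EuclideanSpace ℝ (Fin 3) → ℝ := fun z => fderiv ℝ (v z.1) z.2 (EuclideanSpace.single 2 1) b₀ with hN
  set D : ℝ × EuclideanSpace ℝ (Fin 3) → ℝ := fun z => fderiv ℝ (v z.1) z.2 (EuclideanSpace.single b₀ 1) 2 with hD
  set W : ℝ × EuclideanSpace ℝ (Fin 3) → ℝ := fun z => v z.1 z.2 2 with hW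
  have hanV : AnalyticOnNhd ℝ (uncurry v) (Set.Iio (0 : ℝ) ×ˢ Set.univ) := analyticOnNhd_uncurry hcont (bdd_of_hasTypeITimeDecay hrate) hmild
  have hNan : AnalyticOnNhd ℝ N (Set.Iio (0 : ℝ) ×ˢ Set.univ) := analyticOnNhd_uncurry_fderiv_entry hrate hcont hmild 2 b₀
  have hDan : AnalyticOnNhd ℝ D (Set.Iio (0 : ℝ) ×ˢ Set.univ) := analyticOnNhd_uncurry_fderiv_entry hrate hcont hmild b₀ 2
  have hWan : AnalyticOnNhd ℝ W (Set.Iio (0 : ℝ) ×ˢ Set.univ) := by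
    have e : W = (EuclideanSpace.proj (2 : Fin 3) : EuclideanSpace ℝ (Fin 3) →L[ℝ] ℝ) ∘ uncurry v := by
      funext z; rfl
    rw [e]
    exact (EuclideanSpace.proj (2 : Fin 3)).comp_analyticOnNhd hanV
  -- slices are differentiable
  have hsd : ∀ {t : ℝ}, t < 0 → ∀ y : EuclideanSpace ℝ (Fin 3), DifferentiableAt ℝ (v t) y := fun {t} ht y =>
    (analyticOnNhd_slice hcont (bdd_of_hasTypeITimeDecay hrate) hmild ht y (Set.mem_univ y)).differentiableAt
  -- ## the coordinates `T = dt`, `ℓ = dx_{b₀}`, `e = (0, e_{b₀})`, `f₀ = (1, 0)`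
  set T : ℝ × EuclideanSpace ℝ (Fin 3) →L[ℝ] ℝ := ContinuousLinearMap.fst ℝ ℝ (EuclideanSpace ℝ (Fin 3)) with hT
  set ℓ : ℝ × EuclideanSpace ℝ (Fin 3) →L[ℝ] ℝ :=
    (EuclideanSpace.proj b₀ : EuclideanSpace ℝ (Fin 3) →L[ℝ] ℝ).comp
      (ContinuousLinearMap.snd ℝ ℝ (EuclideanSpace ℝ (Fin 3))) with hℓ
  set e : ℝ × EuclideanSpace ℝ (Fin 3) := ((0 : ℝ), EuclideanSpace.single b₀ (1 : ℝ)) with he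
  set f₀ : ℝ × EuclideanSpace ℝ (Fin 3) := ((1 : ℝ), (0 : EuclideanSpace ℝ (Fin 3))) with hf₀
  have hℓe : ℓ e = 1 := by simp [hℓ, he]
  have hTe : T e = 0 := by simp [hT, he]
  have hTf : T f₀ = 1 := by simp [hT, hf₀]
  have hℓf : ℓ f₀ = 0 := by simp [hℓ, hf₀]
  -- ## hypotheses of the abstract lemma
  have hNc : ContDiffAt ℝ ω N (t₀, x₀) := (hNan _ haS).contDiffAt
  have hDc : ContDiffAt ℝ ω D (t₀, x₀) := (hDan _ haS).contDiffAt
  have hWc : ContDiffAt ℝ ω W (t₀, x₀) := (hWan _ haS).contDiffAt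
  have hnear : ∀ᶠ z in 𝓝 ((t₀, x₀) : ℝ × EuclideanSpace ℝ (Fin 3)),
      z ∈ Set.Iio (0 : ℝ) ×ˢ (Set.univ : Set (EuclideanSpace ℝ (Fin 3))) := hSo.mem_nhds haS
  have hDe : ∀ᶠ z in 𝓝 ((t₀, x₀) : ℝ × EuclideanSpace ℝ (Fin 3)), D z = fderiv ℝ W z e := by
    filter_upwards [hnear] with z hz
    have hz1 : z.1 < 0 := (Set.mem_prod.1 hz).1
    have hWd : DifferentiableAt ℝ W (z.1, z.2) := (hWan _ (by simpa using hz)).differentiableAt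
    rw [he, show z = (z.1, z.2) from rfl, ← fderiv_slice_apply hWd]
    show fderiv ℝ (v z.1) z.2 (EuclideanSpace.single b₀ 1) 2 = fderiv ℝ (fun y => v z.1 y 2) z.2 (EuclideanSpace.single b₀ 1)
    rw [Literature.Analysis.FluidPDE.fderiv_apply_coord (hsd hz1 z.2)]
  have hDa : D (t₀, x₀) ≠ 0 := hpiv
  have hmin : ∀ᶠ z in 𝓝 ((t₀, x₀) : ℝ × EuclideanSpace ℝ (Fin 3)), ∀ h : ℝ × EuclideanSpace ℝ (Fin 3), T h = 0 → fderiv ℝ W z h = 0 →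
      D z * fderiv ℝ N z h - N z * fderiv ℝ D z h = 0 := by
    have hDne : ∀ᶠ z in 𝓝 ((t₀, x₀) : ℝ × EuclideanSpace ℝ (Fin 3)), D z ≠ 0 := hDc.continuousAt.eventually_ne hDa
    filter_upwards [hnear, hDne] with z hz hDz h hTh hWh
    have hz1 : z.1 < 0 := (Set.mem_prod.1 hz).1
    have hzS : (z.1, z.2) ∈ Set.Iio (0 : ℝ) ×ˢ (Set.univ : Set (EuclideanSpace ℝ (Fin 3))) := by simpa using hz
    have hh : h = ((0 : ℝ), h.2) := by
      ext
      · simpa [hT] using hTh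
      · rfl
    -- joint derivatives as slice derivatives
    have eN : fderiv ℝ N z h = fderiv ℝ (fun y => fderiv ℝ (v z.1) y (EuclideanSpace.single 2 1) b₀) z.2 h.2 := by
      rw [hh, show z = (z.1, z.2) from rfl, ← fderiv_slice_apply (hNan _ hzS).differentiableAt]
    have eD : fderiv ℝ D z h = fderiv ℝ (fun y => fderiv ℝ (v z.1) y (EuclideanSpace.single b₀ 1) 2) z.2 h.2 := by
      rw [hh, show z = (z.1, z.2) from rfl, ← fderiv_slice_apply (hDan _ hzS).differentiableAt]
    have eW : fderiv ℝ W z h = fderiv ℝ (fun y => v z.1 y 2) z.2 h.2 := by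
      rw [hh, show z = (z.1, z.2) from rfl, ← fderiv_slice_apply (hWan _ hzS).differentiableAt]
    have eWb : fderiv ℝ (fun y => v z.1 y 2) z.2 (EuclideanSpace.single b₀ 1) = D z := by
      rw [Literature.Analysis.FluidPDE.fderiv_apply_coord (hsd hz1 z.2)]
    have hWu : fderiv ℝ (fun y => v z.1 y 2) z.2 h.2 = 0 := by rw [← eW]; exact hWh
    -- the slab minor with directions `(h.2, e_{b₀})`
    have hM := minors_eq_zero_on_slab_of_class_autonomy C v hrate hcont hmild hW₁ hW₁s hW₁ne haut hz1 hb₀ z.2 h.2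
      (EuclideanSpace.single b₀ 1)
    rw [hWu, eWb, mul_zero, sub_zero] at hM
    rw [eN, eD]
    have h2 := (mul_eq_zero.1 hM).resolve_right hDz
    exact h2
  -- ## the structure function
  obtain ⟨G, hGc, hG⟩ := exists_slope_function₂ (n := ω) (by simp) hℓe hTe hTf hℓf hNc hDc hWc hDe hDa hmin
  have hGc' : ContDiffAt ℝ ω (Function.uncurry fun t w => G (t, w)) (t₀, v t₀ x₀ 2) := by
    have e1 : (Function.uncurry fun t w => G (t, w)) = G := by funext p; rfl
    rw [e1]
    simpa [hT, hW] using hGc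
  -- an open neighbourhood on which the identity holds, inside the slab, with `D ≠ 0`
  have hDne : ∀ᶠ z in 𝓝 ((t₀, x₀) : ℝ × EuclideanSpace ℝ (Fin 3)), D z ≠ 0 := hDc.continuousAt.eventually_ne hDa
  obtain ⟨O, hOsub, hOo, haO⟩ := _root_.mem_nhds_iff.1 (hG.and (hnear.and hDne))
  refine ⟨fun t w => G (t, w), hGc', O, hOo, haO, fun z hz => (hOsub hz).2.1, fun z hz b hb => ?_⟩
  obtain ⟨hGz, hzS, hDz⟩ := hOsub hz
  have hz1 : z.1 < 0 := (Set.mem_prod.1 hzS).1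
  have hGz' : fderiv ℝ (v z.1) z.2 (EuclideanSpace.single 2 1) b₀ =
      G (z.1, v z.1 z.2 2) * fderiv ℝ (v z.1) z.2 (EuclideanSpace.single b₀ 1) 2 := by
    simpa [hN, hD, hW, hT] using hGz
  rcases hcover b hb with rfl | rfl
  · exact hGz'
  · -- the other component from the wedge law `∂_z v₀·∂₁v₂ = ∂_z v₁·∂₀v₂`
    have hwedge := wedge_slice_of_class hrate hcont hmild hdiv hpol hz1 z.2
    have hDz' : fderiv ℝ (v z.1) z.2 (EuclideanSpace.single b₀ 1) 2 ≠ 0 := hDz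
    -- case analysis on `(b₀, b) = (0,1)` or `(1,0)`
    have hcases : (b₀ = 0 ∧ b = 1) ∨ (b₀ = 1 ∧ b = 0) := by
      revert hb₀ hb hb01
      fin_cases b₀ <;> fin_cases b <;> simp
    rcases hcases with ⟨rfl, rfl⟩ | ⟨rfl, rfl⟩
    · -- `∂_z v₁ = ∂_z v₀ ∂₁v₂ / ∂₀v₂ = G ∂₁ v₂`
      have h1 : fderiv ℝ (v z.1) z.2 (EuclideanSpace.single 2 1) 1 * fderiv ℝ (v z.1) z.2 (EuclideanSpace.single 0 1) 2 =
          G (z.1, v z.1 z.2 2) * fderiv ℝ (v z.1) z.2 (EuclideanSpace.single 1 1) 2 *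
            fderiv ℝ (v z.1) z.2 (EuclideanSpace.single 0 1) 2 := by
        linear_combination (-1 : ℝ) * hwedge + fderiv ℝ (v z.1) z.2 (EuclideanSpace.single 1 1) 2 * hGz'
      exact mul_right_cancel₀ hDz' h1
    · have h1 : fderiv ℝ (v z.1) z.2 (EuclideanSpace.single 2 1) 0 * fderiv ℝ (v z.1) z.2 (EuclideanSpace.single 1 1) 2 =
          G (z.1, v z.1 z.2 2) * fderiv ℝ (v z.1) z.2 (EuclideanSpace.single 0 1) 2 *
            fderiv ℝ (v z.1) z.2 (EuclideanSpace.single 1 1) 2 := by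
        linear_combination hwedge + fderiv ℝ (v z.1) z.2 (EuclideanSpace.single 0 1) 2 * hGz'
      exact mul_right_cancel₀ hDz' h1

end Summit.NavierStokesRegularity.NavierStokesRegularity.Theorems.PoloidalWindowDoorPoloidalWindowRigidityZShockSlopeFunctionSpaceTime

end
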